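import Summits.CriticalPhenomena.Ising3D.Control2DRhoCoordinate
import Literature.NumberTheory.ModularForms.EisensteinE4Hypergeometric
import Mathlib.Analysis.SpecialFunctions.Pow.Deriv
import Mathlib.Tactic.Linarith
import Mathlib.Tactic.Positivity
import Mathlib.Tactic.FieldSimp
import Mathlib.Tactic.Ring
import Mathlib.Tactic.LinearCombination
import HarnessLib

/-!
# The radial equation of the chiral blocks: `₂F₁(h,h;2h;4ρ/(1+ρ)²)` and `(1+ρ)^{2h}₂F₁(½,h;h+½;ρ²)` solve the same ODE; Abel's identity
(cell `pub-ising3x`, seat controls-1 gen 48; PAPER §6.2 / Appendix E — CONTROL-ONLY; part 1 of the `ρ`-expansion, used by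
`Control2DRhoExpansion`)

HONEST FRAMING: lottery ticket; floor = tightest certified 3D Ising CFT bounds; no exact-solution
claim without a proof. CONTROL-ONLY (`d = 2`, global `sl(2) × sl(2)` blocks, `Δ_σ = s` an INPUT, axiom set `A2D′`);
nothing here is about `d = 3`, no certificate, functional or number of the record is touched, and no new hypothesis,
definition or named fact enters. PURE REAL ANALYSIS of Mathlib's real `₂F₁` (no datum, no block object yet).

WHAT THIS FILE ADDS. The calculus half of the quadratic transformation (Gauss; Hogervorst–Rychkov's `ρ`-series) by the
differential equation and Abel's identity, proved in `Control2DRhoExpansion`. With `z(ρ) = 4ρ/(1+ρ)²`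
(`z' = 4(1-ρ)/(1+ρ)³`, `z'' = 8(ρ-2)/(1+ρ)⁴`), `Y(ρ) := ₂F₁(h,h;2h;z(ρ))` and `Y₂(ρ) := (1+ρ)^{2h}·₂F₁(½,h;h+½;ρ²)`
(both written out — no definition is introduced) and `h > 0`, `0 < ρ < 1`:

* `radialY_deriv_data`, `radialY₂_deriv_data` — first and second derivatives by the chain and product rules from the
  tree's `d/dx ₂F₁(a,b;c;x) = (ab/c) ₂F₁(a+1,b+1;c+1;x)` (`hasDerivAt_ordinaryHypergeometric`, USED BY NAME);
* **`radialY_ode`**, **`radialY₂_ode`** — BOTH solve the radial equation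
  `ρ(1-ρ²)·y'' + (2h(1-ρ)² - 2ρ²)·y' - (4h²(1-ρ)/(1+ρ))·y = 0`: the first is `4(1-ρ)/(1+ρ)` times the hypergeometric
  equation of `₂F₁(h,h;2h;·)` at `x = z(ρ)`, the second `4ρ(1+ρ)^{2h}` times that of `₂F₁(½,h;h+½;·)` at `x = ρ²`
  (the tree's real `ordinaryHypergeometric_ode`, `c > 0`, `|x| < 1`, USED BY NAME); dividing the equation by `(1+ρ)^{2h}`
  gives Rainville's `x(1-x²)y'' + 2(b - (2a-b+1)x²)y' - 2ax(1+2a-2b)y = 0` at `a = b = h`;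
* **`hasDerivAt_radial_wronskian`** — ABEL'S IDENTITY: with the weight `w = ρ^{2h}(1-ρ)(1+ρ)^{1-4h}` (logarithmic
  derivative `2h/ρ - 1/(1-ρ) + (1-4h)/(1+ρ) = (2h(1-ρ)² - 2ρ²)/(ρ(1-ρ²))`), `Z := w·(Y·Y₂' - Y'·Y₂)` has zero derivative on
  `(0,1)`.

NOT claimed here: the transformation itself (part 2), anything at `h ≤ 0`, `ρ ∉ (0,1)`, complex argument, general
parameters `(a, b)`; nothing of the record. CONTEXT, not inputs: Pappadopulo–Rychkov–Espin–Rattazzi 2012 §5 and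
Hogervorst–Rychkov 2013 (the `ρ`-coordinate and the `ρ`-series of the blocks), Andrews–Askey–Roy §3.1 / arXiv:1411.5262
§1–§2 (Gauss's transformation `₂F₁(a,b;2b;4x/(1+x)²) = (1+x)^{2a}₂F₁(a,a-b+½;b+½;x²)` and Rainville's derivation by the
differential equation); INPUTS = the two tree theorems named above. The worked precedent of the method in the tree is
`Literature/NumberTheory/Automorphic/LegendrePQuadraticTransformation.lean` (AAR (3.1.3), other parameters; not imported).

References: G. E. Andrews, R. Askey, R. Roy, *Special Functions* (1999), §3.1 [cite: AndrewsAskeyRoy1999, §3.1];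
M. Hogervorst, S. Rychkov, Phys. Rev. D 87 (2013) 106004, §2 [cite: HogervorstRychkov2013, §2]; D. Pappadopulo, S. Rychkov,
J. Espin, R. Rattazzi, Phys. Rev. D 86 (2012) 105043, §5.2 [cite: PappadopuloRychkovEspinRattazzi2012PRD, §5.2]. Tree:
`four_mul_div_sq_mem_Ioo` (`Control2DRhoCoordinate`); `Literature.NumberTheory.Automorphic.LegendreP.hasDerivAt_ordinaryHypergeometric`
(`ZhouLegendreGreenValuesProofs`); `Literature.NumberTheory.ModularForms.ordinaryHypergeometric_ode`
(`EisensteinE4Hypergeometric`). Mathlib: `ordinaryHypergeometric`, `Real.hasDerivAt_rpow_const`, `Real.rpow_sub_one`,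
`HasDerivAt.comp/mul/div`, `field_simp`, `ring`.
-/

namespace Summit.CriticalPhenomena.Ising3D.Control2D

open Set Filter Topology
open Literature.NumberTheory.Automorphic.LegendreP (hasDerivAt_ordinaryHypergeometric)
open Literature.NumberTheory.ModularForms (ordinaryHypergeometric_ode)

/-! ### The map `ρ ↦ z(ρ) = 4ρ/(1+ρ)²` and its first two derivatives -/

/-- `dz/dρ = 4(1-ρ)/(1+ρ)³` for `z(ρ) = 4ρ/(1+ρ)²` (`ρ ≠ -1`). [folklore] -/
theorem hasDerivAt_four_mul_div_sq {ρ : ℝ} (hρ : 1 + ρ ≠ 0) :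
    HasDerivAt (fun r : ℝ => 4 * r / (1 + r) ^ 2) (4 * (1 - ρ) / (1 + ρ) ^ 3) ρ := by
  have hnum : HasDerivAt (fun r : ℝ => 4 * r) 4 ρ := by
    simpa using (hasDerivAt_id ρ).const_mul 4
  have hden : HasDerivAt (fun r : ℝ => (1 + r) ^ 2) (2 * (1 + ρ)) ρ :=
    (((hasDerivAt_id' ρ).const_add 1).fun_pow 2).congr_deriv (by norm_num)
  refine (hnum.div hden (pow_ne_zero 2 hρ)).congr_deriv ?_
  field_simp
  ring

/-- `d²z/dρ² = 8(ρ-2)/(1+ρ)⁴`, as the derivative of `4(1-ρ)/(1+ρ)³` (`ρ ≠ -1`). [folklore] -/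
theorem hasDerivAt_four_mul_one_sub_div_cube {ρ : ℝ} (hρ : 1 + ρ ≠ 0) :
    HasDerivAt (fun r : ℝ => 4 * (1 - r) / (1 + r) ^ 3) (8 * (ρ - 2) / (1 + ρ) ^ 4) ρ := by
  have hnum : HasDerivAt (fun r : ℝ => 4 * (1 - r)) (-4) ρ := by
    simpa using ((hasDerivAt_id ρ).const_sub 1).const_mul 4
  have hden : HasDerivAt (fun r : ℝ => (1 + r) ^ 3) (3 * (1 + ρ) ^ 2) ρ :=
    (((hasDerivAt_id' ρ).const_add 1).fun_pow 3).congr_deriv (by norm_num)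
  refine (hnum.div hden (pow_ne_zero 3 hρ)).congr_deriv ?_
  field_simp
  ring

/-! ### `Y(ρ) = ₂F₁(h,h;2h;z(ρ))` solves the radial equation -/

/-- Derivative data of `Y(ρ) = ₂F₁(h,h;2h;4ρ/(1+ρ)²)` on `(0,1)`: `Y' = g₁(z)·z'`, `Y'' = g₂(z)·z'² + g₁(z)·z''`
with `g₁ = (h·h/(2h)) ₂F₁(h+1,h+1;2h+1;·)`, `g₂ = (h·h/(2h))((h+1)(h+1)/(2h+1)) ₂F₁(h+2,h+2;2h+2;·)` (chain rule with
the tree's `d/dx ₂F₁ = (ab/c) ₂F₁(a+1,b+1;c+1;·)`). [folklore] -/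
theorem radialY_deriv_data (h : ℝ) {ρ : ℝ} (hρ : ρ ∈ Ioo (0 : ℝ) 1) :
    let g₁ := h * h / (2 * h) * ordinaryHypergeometric (h + 1) (h + 1) (2 * h + 1) (4 * ρ / (1 + ρ) ^ 2)
    let g₂ := h * h / (2 * h) * ((h + 1) * (h + 1) / (2 * h + 1) *
      ordinaryHypergeometric (h + 1 + 1) (h + 1 + 1) (2 * h + 1 + 1) (4 * ρ / (1 + ρ) ^ 2))
    HasDerivAt (fun r : ℝ => ordinaryHypergeometric h h (2 * h) (4 * r / (1 + r) ^ 2))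
        (g₁ * (4 * (1 - ρ) / (1 + ρ) ^ 3)) ρ ∧
      HasDerivAt (deriv fun r : ℝ => ordinaryHypergeometric h h (2 * h) (4 * r / (1 + r) ^ 2))
        (g₂ * (4 * (1 - ρ) / (1 + ρ) ^ 3) * (4 * (1 - ρ) / (1 + ρ) ^ 3) +
          g₁ * (8 * (ρ - 2) / (1 + ρ) ^ 4)) ρ := by
  intro g₁ g₂
  have hz : ∀ r ∈ Ioo (0 : ℝ) 1, |4 * r / (1 + r) ^ 2| < 1 := fun r hr => by
    have h := four_mul_div_sq_mem_Ioo hr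
    rw [abs_of_pos h.1]; exact h.2
  have hne : ∀ r ∈ Ioo (0 : ℝ) 1, 1 + r ≠ 0 := fun r hr => by linarith [hr.1]
  -- first derivative at every point of the open interval
  have hd1 : ∀ r ∈ Ioo (0 : ℝ) 1,
      HasDerivAt (fun r : ℝ => ordinaryHypergeometric h h (2 * h) (4 * r / (1 + r) ^ 2))
        (h * h / (2 * h) * ordinaryHypergeometric (h + 1) (h + 1) (2 * h + 1) (4 * r / (1 + r) ^ 2) *
          (4 * (1 - r) / (1 + r) ^ 3)) r := by
    intro r hr
    exact (hasDerivAt_ordinaryHypergeometric (a := h) (b := h) (c := 2 * h) (hz r hr)).comp r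
      (hasDerivAt_four_mul_div_sq (hne r hr))
  refine ⟨hd1 ρ hρ, ?_⟩
  have hev : deriv (fun r : ℝ => ordinaryHypergeometric h h (2 * h) (4 * r / (1 + r) ^ 2)) =ᶠ[𝓝 ρ]
      fun r => h * h / (2 * h) * ordinaryHypergeometric (h + 1) (h + 1) (2 * h + 1) (4 * r / (1 + r) ^ 2) *
        (4 * (1 - r) / (1 + r) ^ 3) := by
    filter_upwards [Ioo_mem_nhds hρ.1 hρ.2] with r hr
    exact (hd1 r hr).deriv
  have h2 := ((hasDerivAt_ordinaryHypergeometric (a := h + 1) (b := h + 1) (c := 2 * h + 1) (hz ρ hρ)).comp ρ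
    (hasDerivAt_four_mul_div_sq (hne ρ hρ))).const_mul (h * h / (2 * h))
  have h3 := h2.fun_mul (hasDerivAt_four_mul_one_sub_div_cube (hne ρ hρ))
  refine (h3.congr_of_eventuallyEq (hev.trans (Eventually.of_forall fun r => by
    simp only [Function.comp_apply]))).congr_deriv ?_
  simp only [Function.comp_apply]
  ring

/-- **The radial equation for `Y(ρ) = ₂F₁(h,h;2h;4ρ/(1+ρ)²)`** (`h > 0`, `0 < ρ < 1`):
`ρ(1-ρ²)·Y'' + (2h(1-ρ)² - 2ρ²)·Y' - (4h²(1-ρ)/(1+ρ))·Y = 0` — it is `4(1-ρ)/(1+ρ)` times the hypergeometric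
equation of `₂F₁(h,h;2h;·)` at `x = z(ρ)` (the tree's `ordinaryHypergeometric_ode`, by name), by the chain rule with
`z' = 4(1-ρ)/(1+ρ)³`, `z'' = 8(ρ-2)/(1+ρ)⁴`. [cite: AndrewsAskeyRoy1999, §3.1] -/
theorem radialY_ode {h : ℝ} (hh : 0 < h) {ρ : ℝ} (hρ : ρ ∈ Ioo (0 : ℝ) 1) :
    ρ * (1 - ρ ^ 2) * deriv (deriv fun r : ℝ => ordinaryHypergeometric h h (2 * h) (4 * r / (1 + r) ^ 2)) ρ +
      (2 * h * (1 - ρ) ^ 2 - 2 * ρ ^ 2) *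
        deriv (fun r : ℝ => ordinaryHypergeometric h h (2 * h) (4 * r / (1 + r) ^ 2)) ρ -
      4 * h ^ 2 * (1 - ρ) / (1 + ρ) * ordinaryHypergeometric h h (2 * h) (4 * ρ / (1 + ρ) ^ 2) = 0 := by
  obtain ⟨hd, hdd⟩ := radialY_deriv_data h hρ
  have hzI := four_mul_div_sq_mem_Ioo hρ
  have hz : |4 * ρ / (1 + ρ) ^ 2| < 1 := by rw [abs_of_pos hzI.1]; exact hzI.2
  have hode := ordinaryHypergeometric_ode (a := h) (b := h) (c := 2 * h) (by positivity) hz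
  rw [hd.deriv, hdd.deriv]
  have h1 : (1 : ℝ) + ρ ≠ 0 := by linarith [hρ.1]
  set G₀ := ordinaryHypergeometric h h (2 * h) (4 * ρ / (1 + ρ) ^ 2)
  set G₁ := ordinaryHypergeometric (h + 1) (h + 1) (2 * h + 1) (4 * ρ / (1 + ρ) ^ 2)
  set G₂ := ordinaryHypergeometric (h + 1 + 1) (h + 1 + 1) (2 * h + 1 + 1) (4 * ρ / (1 + ρ) ^ 2)
  have key : ρ * (1 - ρ ^ 2) *
        (h * h / (2 * h) * ((h + 1) * (h + 1) / (2 * h + 1) * G₂) * (4 * (1 - ρ) / (1 + ρ) ^ 3) *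
            (4 * (1 - ρ) / (1 + ρ) ^ 3) +
          h * h / (2 * h) * G₁ * (8 * (ρ - 2) / (1 + ρ) ^ 4)) +
      (2 * h * (1 - ρ) ^ 2 - 2 * ρ ^ 2) * (h * h / (2 * h) * G₁ * (4 * (1 - ρ) / (1 + ρ) ^ 3)) -
      4 * h ^ 2 * (1 - ρ) / (1 + ρ) * G₀ =
      4 * (1 - ρ) / (1 + ρ) *
        (4 * ρ / (1 + ρ) ^ 2 * (1 - 4 * ρ / (1 + ρ) ^ 2) *
            (h * h / (2 * h) * ((h + 1) * (h + 1) / (2 * h + 1) * G₂)) +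
          (2 * h - (h + h + 1) * (4 * ρ / (1 + ρ) ^ 2)) * (h * h / (2 * h) * G₁) - h * h * G₀) := by
    field_simp
    ring
  rw [key, hode, mul_zero]


/-! ### `Y₂(ρ) = (1+ρ)^{2h} ₂F₁(½,h;h+½;ρ²)` solves the same radial equation -/

/-- `d/dρ (1+ρ)^p = p (1+ρ)^{p-1}` (`ρ > -1`). [folklore] -/
theorem hasDerivAt_one_add_rpow {ρ : ℝ} (hρ : 0 < 1 + ρ) (p : ℝ) :
    HasDerivAt (fun r : ℝ => (1 + r) ^ p) (p * (1 + ρ) ^ (p - 1)) ρ := by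
  have h := (Real.hasDerivAt_rpow_const (x := 1 + ρ) (p := p) (Or.inl hρ.ne')).comp ρ
    ((hasDerivAt_id' ρ).const_add 1)
  exact (h.congr_of_eventuallyEq (Eventually.of_forall fun r => rfl)).congr_deriv (mul_one _)

/-- Derivative data of `Y₂(ρ) = (1+ρ)^{2h}·₂F₁(½,h;h+½;ρ²)` on `(0,1)`: with `u = (1+ρ)^{2h}`, `u' = 2h(1+ρ)^{2h-1}`,
`u'' = 2h(2h-1)(1+ρ)^{2h-2}`, `G = ₂F₁(½,h;h+½;ρ²)`, `G' = 2ρ k₁(ρ²)`, `G'' = 4ρ² k₂(ρ²) + 2k₁(ρ²)`: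
`Y₂' = u'G + uG'`, `Y₂'' = u''G + 2u'G' + uG''`. [folklore] -/
theorem radialY₂_deriv_data {h ρ : ℝ} (hρ : ρ ∈ Ioo (0 : ℝ) 1) :
    let k₀ := ordinaryHypergeometric (1 / 2) h (h + 1 / 2) (ρ ^ 2)
    let k₁ := 1 / 2 * h / (h + 1 / 2) * ordinaryHypergeometric (1 / 2 + 1) (h + 1) (h + 1 / 2 + 1) (ρ ^ 2)
    let k₂ := 1 / 2 * h / (h + 1 / 2) * ((1 / 2 + 1) * (h + 1) / (h + 1 / 2 + 1) *
      ordinaryHypergeometric (1 / 2 + 1 + 1) (h + 1 + 1) (h + 1 / 2 + 1 + 1) (ρ ^ 2))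
    let u := (1 + ρ) ^ (2 * h)
    let u₁ := 2 * h * (1 + ρ) ^ (2 * h - 1)
    let u₂ := 2 * h * ((2 * h - 1) * (1 + ρ) ^ (2 * h - 1 - 1))
    HasDerivAt (fun r : ℝ => (1 + r) ^ (2 * h) * ordinaryHypergeometric (1 / 2) h (h + 1 / 2) (r ^ 2))
        (u₁ * k₀ + u * (k₁ * (2 * ρ))) ρ ∧
      HasDerivAt
        (deriv fun r : ℝ => (1 + r) ^ (2 * h) * ordinaryHypergeometric (1 / 2) h (h + 1 / 2) (r ^ 2))
        (u₂ * k₀ + u₁ * (k₁ * (2 * ρ)) + (u₁ * (k₁ * (2 * ρ)) + u * (k₂ * (2 * ρ) * (2 * ρ) + k₁ * 2))) ρ := by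
  intro k₀ k₁ k₂ u u₁ u₂
  have hpos : ∀ r ∈ Ioo (0 : ℝ) 1, 0 < 1 + r := fun r hr => by linarith [hr.1]
  have habs : ∀ r ∈ Ioo (0 : ℝ) 1, |r ^ 2| < 1 := fun r hr => by
    rw [abs_of_nonneg (sq_nonneg r)]; nlinarith [hr.1, hr.2]
  have hsq : ∀ r : ℝ, HasDerivAt (fun r : ℝ => r ^ 2) (2 * r) r := fun r => by
    simpa using hasDerivAt_pow 2 r
  -- first derivative on the open interval
  have hd1 : ∀ r ∈ Ioo (0 : ℝ) 1,
      HasDerivAt (fun r : ℝ => (1 + r) ^ (2 * h) * ordinaryHypergeometric (1 / 2) h (h + 1 / 2) (r ^ 2))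
        (2 * h * (1 + r) ^ (2 * h - 1) * ordinaryHypergeometric (1 / 2) h (h + 1 / 2) (r ^ 2) +
          (1 + r) ^ (2 * h) * (1 / 2 * h / (h + 1 / 2) *
            ordinaryHypergeometric (1 / 2 + 1) (h + 1) (h + 1 / 2 + 1) (r ^ 2) * (2 * r))) r := by
    intro r hr
    have hG := (hasDerivAt_ordinaryHypergeometric (a := 1 / 2) (b := h) (c := h + 1 / 2)
      (habs r hr)).comp (h := fun r : ℝ => r ^ 2) r (hsq r)
    exact (hasDerivAt_one_add_rpow (hpos r hr) (2 * h)).mul hG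
  refine ⟨hd1 ρ hρ, ?_⟩
  have hev : deriv (fun r : ℝ => (1 + r) ^ (2 * h) * ordinaryHypergeometric (1 / 2) h (h + 1 / 2) (r ^ 2))
      =ᶠ[𝓝 ρ] fun r => 2 * h * (1 + r) ^ (2 * h - 1) * ordinaryHypergeometric (1 / 2) h (h + 1 / 2) (r ^ 2) +
          (1 + r) ^ (2 * h) * (1 / 2 * h / (h + 1 / 2) *
            ordinaryHypergeometric (1 / 2 + 1) (h + 1) (h + 1 / 2 + 1) (r ^ 2) * (2 * r)) := by
    filter_upwards [Ioo_mem_nhds hρ.1 hρ.2] with r hr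
    exact (hd1 r hr).deriv
  -- the pieces at `ρ`
  have hu : HasDerivAt (fun r : ℝ => (1 + r) ^ (2 * h)) u₁ ρ := hasDerivAt_one_add_rpow (hpos ρ hρ) (2 * h)
  have hu₁ : HasDerivAt (fun r : ℝ => 2 * h * (1 + r) ^ (2 * h - 1)) u₂ ρ :=
    (hasDerivAt_one_add_rpow (hpos ρ hρ) (2 * h - 1)).const_mul (2 * h)
  have hG : HasDerivAt (fun r : ℝ => ordinaryHypergeometric (1 / 2) h (h + 1 / 2) (r ^ 2)) (k₁ * (2 * ρ)) ρ :=
    (hasDerivAt_ordinaryHypergeometric (a := 1 / 2) (b := h) (c := h + 1 / 2)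
      (habs ρ hρ)).comp (h := fun r : ℝ => r ^ 2) ρ (hsq ρ)
  have hG₁ : HasDerivAt (fun r : ℝ => 1 / 2 * h / (h + 1 / 2) *
      ordinaryHypergeometric (1 / 2 + 1) (h + 1) (h + 1 / 2 + 1) (r ^ 2) * (2 * r))
      (k₂ * (2 * ρ) * (2 * ρ) + k₁ * 2) ρ := by
    have h2 := ((hasDerivAt_ordinaryHypergeometric (a := 1 / 2 + 1) (b := h + 1) (c := h + 1 / 2 + 1)
      (habs ρ hρ)).comp (h := fun r : ℝ => r ^ 2) ρ (hsq ρ)).const_mul (1 / 2 * h / (h + 1 / 2))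
    have hlin : HasDerivAt (fun y : ℝ => 2 * y) 2 ρ := by simpa using (hasDerivAt_id' ρ).const_mul 2
    have h3 := h2.mul hlin
    refine (h3.congr_of_eventuallyEq (Eventually.of_forall fun r => by
      simp only [Function.comp_apply, Pi.mul_apply])).congr_deriv ?_
    simp only [Function.comp_apply]
    ring
  have h4 := (hu₁.mul hG).add (hu.mul hG₁)
  refine (h4.congr_of_eventuallyEq (hev.trans (Eventually.of_forall fun r => by
    simp only [Pi.add_apply, Pi.mul_apply]))).congr_deriv ?_
  ring

/-- **The radial equation for `Y₂(ρ) = (1+ρ)^{2h}·₂F₁(½,h;h+½;ρ²)`** (`h > 0`, `0 < ρ < 1`):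
`ρ(1-ρ²)·Y₂'' + (2h(1-ρ)² - 2ρ²)·Y₂' - (4h²(1-ρ)/(1+ρ))·Y₂ = 0` — it is `4ρ(1+ρ)^{2h}` times the hypergeometric
equation of `₂F₁(½,h;h+½;·)` at `x = ρ²` (the tree's `ordinaryHypergeometric_ode`, by name); Rainville's equation
`x(1-x²)y'' + 2(b - (2a-b+1)x²)y' - 2ax(1+2a-2b)y = 0` for `y = (1+x)^{-2a}₂F₁(a,b;2b;4x/(1+x)²)` at `a = b = h`.
[cite: AndrewsAskeyRoy1999, §3.1] -/
theorem radialY₂_ode {h : ℝ} (hh : 0 < h) {ρ : ℝ} (hρ : ρ ∈ Ioo (0 : ℝ) 1) :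
    ρ * (1 - ρ ^ 2) *
        deriv (deriv fun r : ℝ => (1 + r) ^ (2 * h) * ordinaryHypergeometric (1 / 2) h (h + 1 / 2) (r ^ 2)) ρ +
      (2 * h * (1 - ρ) ^ 2 - 2 * ρ ^ 2) *
        deriv (fun r : ℝ => (1 + r) ^ (2 * h) * ordinaryHypergeometric (1 / 2) h (h + 1 / 2) (r ^ 2)) ρ -
      4 * h ^ 2 * (1 - ρ) / (1 + ρ) *
        ((1 + ρ) ^ (2 * h) * ordinaryHypergeometric (1 / 2) h (h + 1 / 2) (ρ ^ 2)) = 0 := by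
  obtain ⟨hd, hdd⟩ := radialY₂_deriv_data (h := h) hρ
  have habs : |ρ ^ 2| < 1 := by rw [abs_of_nonneg (sq_nonneg ρ)]; nlinarith [hρ.1, hρ.2]
  have hode := ordinaryHypergeometric_ode (a := 1 / 2) (b := h) (c := h + 1 / 2) (by positivity) habs
  rw [hd.deriv, hdd.deriv]
  have h1 : (0 : ℝ) < 1 + ρ := by linarith [hρ.1]
  have hr1 : (1 + ρ) ^ (2 * h - 1) = (1 + ρ) ^ (2 * h) / (1 + ρ) := by
    rw [Real.rpow_sub h1, Real.rpow_one]
  have hr2 : (1 + ρ) ^ (2 * h - 1 - 1) = (1 + ρ) ^ (2 * h) / (1 + ρ) ^ 2 := by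
    rw [show 2 * h - 1 - 1 = 2 * h - 2 by ring, Real.rpow_sub h1, Real.rpow_two]
  rw [hr1, hr2]
  set U := (1 + ρ) ^ (2 * h)
  set K₀ := ordinaryHypergeometric (1 / 2) h (h + 1 / 2) (ρ ^ 2)
  set K₁ := ordinaryHypergeometric (1 / 2 + 1) (h + 1) (h + 1 / 2 + 1) (ρ ^ 2)
  set K₂ := ordinaryHypergeometric (1 / 2 + 1 + 1) (h + 1 + 1) (h + 1 / 2 + 1 + 1) (ρ ^ 2)
  have h1' : (1 : ℝ) + ρ ≠ 0 := h1.ne'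
  have hc : (h : ℝ) + 1 / 2 ≠ 0 := by positivity
  have hc' : (h : ℝ) + 1 / 2 + 1 ≠ 0 := by positivity
  have key : ρ * (1 - ρ ^ 2) *
        (2 * h * ((2 * h - 1) * (U / (1 + ρ) ^ 2)) * K₀ + 2 * h * (U / (1 + ρ)) * (1 / 2 * h / (h + 1 / 2) * K₁ * (2 * ρ)) +
          (2 * h * (U / (1 + ρ)) * (1 / 2 * h / (h + 1 / 2) * K₁ * (2 * ρ)) +
            U * (1 / 2 * h / (h + 1 / 2) * ((1 / 2 + 1) * (h + 1) / (h + 1 / 2 + 1) * K₂) * (2 * ρ) * (2 * ρ) +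
              1 / 2 * h / (h + 1 / 2) * K₁ * 2))) +
      (2 * h * (1 - ρ) ^ 2 - 2 * ρ ^ 2) *
        (2 * h * (U / (1 + ρ)) * K₀ + U * (1 / 2 * h / (h + 1 / 2) * K₁ * (2 * ρ))) -
      4 * h ^ 2 * (1 - ρ) / (1 + ρ) * (U * K₀) =
      4 * ρ * U *
        (ρ ^ 2 * (1 - ρ ^ 2) * (1 / 2 * h / (h + 1 / 2) * ((1 / 2 + 1) * (h + 1) / (h + 1 / 2 + 1) * K₂)) +
          (h + 1 / 2 - (1 / 2 + h + 1) * ρ ^ 2) * (1 / 2 * h / (h + 1 / 2) * K₁) - 1 / 2 * h * K₀) := by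
    field_simp
    ring
  rw [key, hode, mul_zero]


/-! ### Abel's identity: the weighted Wronskian is constant -/

/-- **Abel's identity for the radial equation.** With `Y(ρ) = ₂F₁(h,h;2h;4ρ/(1+ρ)²)`,
`Y₂(ρ) = (1+ρ)^{2h}₂F₁(½,h;h+½;ρ²)` and the weight `w(ρ) = ρ^{2h}(1-ρ)(1+ρ)^{1-4h}` (whose logarithmic derivative
`2h/ρ - 1/(1-ρ) + (1-4h)/(1+ρ) = (2h(1-ρ)² - 2ρ²)/(ρ(1-ρ²))` is the equation's coefficient ratio),
`Z := w·(Y·Y₂' - Y'·Y₂)` has zero derivative on `(0,1)`. [folklore] -/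
theorem hasDerivAt_radial_wronskian {h : ℝ} (hh : 0 < h) {ρ : ℝ} (hρ : ρ ∈ Ioo (0 : ℝ) 1) :
    HasDerivAt (fun r : ℝ => r ^ (2 * h) * (1 - r) * (1 + r) ^ (1 - 4 * h) *
      (ordinaryHypergeometric h h (2 * h) (4 * r / (1 + r) ^ 2) *
          deriv (fun r : ℝ => (1 + r) ^ (2 * h) * ordinaryHypergeometric (1 / 2) h (h + 1 / 2) (r ^ 2)) r -
        deriv (fun r : ℝ => ordinaryHypergeometric h h (2 * h) (4 * r / (1 + r) ^ 2)) r *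
          ((1 + r) ^ (2 * h) * ordinaryHypergeometric (1 / 2) h (h + 1 / 2) (r ^ 2)))) 0 ρ := by
  set Yf : ℝ → ℝ := fun r => ordinaryHypergeometric h h (2 * h) (4 * r / (1 + r) ^ 2) with hYf
  set Vf : ℝ → ℝ := fun r => (1 + r) ^ (2 * h) * ordinaryHypergeometric (1 / 2) h (h + 1 / 2) (r ^ 2)
    with hVf
  have hρ0 : 0 < ρ := hρ.1
  have h1 : (0 : ℝ) < 1 + ρ := by linarith
  have hd : ρ * (1 - ρ ^ 2) ≠ 0 := by
    have : 0 < 1 - ρ ^ 2 := by nlinarith [hρ.1, hρ.2]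
    positivity
  -- derivative data
  obtain ⟨hY, hY'⟩ := radialY_deriv_data h hρ
  obtain ⟨hV, hV'⟩ := radialY₂_deriv_data (h := h) hρ
  have hYd : HasDerivAt Yf (deriv Yf ρ) ρ := hY.differentiableAt.hasDerivAt
  have hY'd : HasDerivAt (deriv Yf) (deriv (deriv Yf) ρ) ρ := hY'.differentiableAt.hasDerivAt
  have hVd : HasDerivAt Vf (deriv Vf ρ) ρ := hV.differentiableAt.hasDerivAt
  have hV'd : HasDerivAt (deriv Vf) (deriv (deriv Vf) ρ) ρ := hV'.differentiableAt.hasDerivAt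
  -- the two equations, solved for the second derivatives
  have hodeY := radialY_ode hh hρ
  have hodeV := radialY₂_ode hh hρ
  have eY : deriv (deriv Yf) ρ = (4 * h ^ 2 * (1 - ρ) / (1 + ρ) * Yf ρ -
      (2 * h * (1 - ρ) ^ 2 - 2 * ρ ^ 2) * deriv Yf ρ) / (ρ * (1 - ρ ^ 2)) := by
    rw [eq_div_iff hd]; simp only [hYf]; linarith [hodeY]
  have eV : deriv (deriv Vf) ρ = (4 * h ^ 2 * (1 - ρ) / (1 + ρ) * Vf ρ -
      (2 * h * (1 - ρ) ^ 2 - 2 * ρ ^ 2) * deriv Vf ρ) / (ρ * (1 - ρ ^ 2)) := by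
    rw [eq_div_iff hd]; simp only [hVf]; linarith [hodeV]
  -- the weight
  have hA : HasDerivAt (fun r : ℝ => r ^ (2 * h)) (2 * h * ρ ^ (2 * h - 1)) ρ :=
    Real.hasDerivAt_rpow_const (Or.inl hρ0.ne')
  have hB : HasDerivAt (fun r : ℝ => (1 + r) ^ (1 - 4 * h)) ((1 - 4 * h) * (1 + ρ) ^ (1 - 4 * h - 1)) ρ :=
    hasDerivAt_one_add_rpow h1 (1 - 4 * h)
  have hL : HasDerivAt (fun r : ℝ => 1 - r) (-1) ρ := by simpa using (hasDerivAt_id' ρ).const_sub 1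
  have hw := (hA.mul hL).mul hB
  have hW := (hYd.mul hV'd).sub (hY'd.mul hVd)
  have hZ := hw.mul hW
  refine (hZ.congr_of_eventuallyEq (Eventually.of_forall fun r => by
    simp only [Pi.mul_apply, Pi.sub_apply, hYf, hVf])).congr_deriv ?_
  have hrA : ρ ^ (2 * h - 1) = ρ ^ (2 * h) / ρ := Real.rpow_sub_one hρ0.ne' _
  have hrB : (1 + ρ) ^ (1 - 4 * h - 1) = (1 + ρ) ^ (1 - 4 * h) / (1 + ρ) := Real.rpow_sub_one h1.ne' _
  simp only [Pi.mul_apply, Pi.sub_apply]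
  rw [hrA, hrB, eY, eV]
  have h1' : (1 : ℝ) + ρ ≠ 0 := h1.ne'
  have h2' : (1 : ℝ) - ρ ^ 2 ≠ 0 := by nlinarith [hρ.1, hρ.2]
  field_simp
  ring

end Summit.CriticalPhenomena.Ising3D.Control2D
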